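import Literature.RingTheory.Etale.IndEtaleFactorization
import Mathlib.CategoryTheory.Presentable.Directed
import Mathlib.CategoryTheory.Filtered.Final
import HarnessLib

/-!
# Ind-étale algebras: directed presentations from the factorization criterion

`IndEtaleFactorization.lean` introduced the factorization criterion `FactorsEtale A C` (every map
from a finitely presented `A`-algebra to `C` factors through an étale `A`-algebra) and proved its
closure properties with explicitly presented middle terms. Here we prove that the criterion is
**equivalent to being a directed colimit of étale algebras** (Bhatt–Scholze: "the category of
ind-étale algebras is equivalent to the ind-category of étale algebras by finite presentation
constraints"; Stacks Project, Tag 097I with Tag 0032):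

* `EtaleModel A C` — the small category of étale `A`-algebras presented as quotients of
  polynomial rings `A[x₁,…,xₙ]/I`, equipped with an `A`-algebra map to `C`; it is **filtered** when
  `FactorsEtale A C` holds (`EtaleModel.isFiltered`: sums are tensor products, coequalizers are
  the pushouts `B₂ ⊗_{B₁ ⊗ B₁} B₁`, which are étale);
* `FactorsEtale.exists_directLimit_equiv` — **presentation theorem**: if `FactorsEtale A C` then
  `C ≅ colimᵢ Gᵢ` for a directed system of étale `A`-algebras over a nonempty directed preorder
  (Deligne's Tag 0032, Mathlib `IsFiltered.exists_directed`, turns the filtered category into a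
  directed poset with a final functor; the comparison map is bijective by the criterion);
  conversely `FactorsEtale.of_directLimit_equiv`;
* consequences: `FactorsEtale.trans` (Tag 097K), `FactorsEtale.baseChange` (Tag 097J),
  `FactorsEtale.localization`.

## References

* The Stacks Project, Tags 097I–097N, 0032. [StacksProject]
* B. Bhatt, P. Scholze, *The pro-étale topology for schemes*, Astérisque 369 (2015), §2.2–2.3.
  [BhattScholze2015]

## Design notes

* `EtaleModel A C : Type u` (indices `n : ℕ`, ideals of `MvPolynomial (Fin n) A`, maps to `C`),
  so the category is small and `IsFiltered.exists_directed` yields an index poset in `Type u`.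
* The comparison `colim G ≅ C` is proved by hand (surjective: every element is reached through an
  étale algebra; injective: an element killed in `C` is killed by a morphism of models, and final
  functors out of filtered categories coequalize, `Functor.Final.exists_coeq`).
-/

universe u

namespace Literature.RingTheory.Etale

open TensorProduct CategoryTheory

variable (A C : Type u) [CommRing A] [CommRing C] [Algebra A C]

/-! ### The filtered category of étale models over `C` -/

/-- An **étale model over `C`**: an étale `A`-algebra presented as `A[x₁,…,xₙ]/I` together with an
`A`-algebra map to `C` (the objects of the comma category of étale `A`-algebras over `C`, made
small). [cite: StacksProject, Tag 097I] -/
structure EtaleModel : Type u where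
  /-- number of variables -/
  n : ℕ
  /-- the ideal of relations -/
  I : Ideal (MvPolynomial (Fin n) A)
  /-- the quotient is étale -/
  etale : Algebra.Etale A (MvPolynomial (Fin n) A ⧸ I)
  /-- the structure map to `C` -/
  hom : (MvPolynomial (Fin n) A ⧸ I) →ₐ[A] C

namespace EtaleModel

variable {A C}

/-- The étale algebra of a model. [folklore] -/
abbrev ring (j : EtaleModel A C) : Type u := MvPolynomial (Fin j.n) A ⧸ j.I

/-- The algebra of a model is étale. [folklore] -/
instance etale_ring (j : EtaleModel A C) : Algebra.Etale A j.ring := j.etale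

/-- Morphisms of étale models: `A`-algebra maps over `C`. [folklore] -/
@[ext]
structure Hom (j j' : EtaleModel A C) : Type u where
  /-- the underlying algebra map -/
  toAlgHom : j.ring →ₐ[A] j'.ring
  comp : j'.hom.comp toAlgHom = j.hom

/-- The category of étale models over `C`. [folklore] -/
noncomputable instance category : SmallCategory (EtaleModel A C) where
  Hom := Hom
  id j := ⟨AlgHom.id A j.ring, AlgHom.comp_id _⟩
  comp u v := ⟨v.toAlgHom.comp u.toAlgHom, by rw [← AlgHom.comp_assoc, v.comp, u.comp]⟩
  id_comp u := Hom.ext (AlgHom.comp_id u.toAlgHom)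
  comp_id u := Hom.ext (AlgHom.id_comp u.toAlgHom)
  assoc _ _ _ := rfl

/-- The identity morphism. [folklore] -/
@[simp] theorem id_toAlgHom (j : EtaleModel A C) : (𝟙 j : Hom j j).toAlgHom = AlgHom.id A j.ring := rfl

/-- Composition of morphisms. [folklore] -/
@[simp] theorem comp_toAlgHom {j j' j'' : EtaleModel A C} (u : j ⟶ j') (v : j' ⟶ j'') :
    (u ≫ v).toAlgHom = v.toAlgHom.comp u.toAlgHom := rfl

/-- Morphisms are compatible with the maps to `C`. [folklore] -/
theorem hom_comp_apply {j j' : EtaleModel A C} (u : j ⟶ j') (x : j.ring) :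
    j'.hom (u.toAlgHom x) = j.hom x :=
  congrArg (fun ψ : j.ring →ₐ[A] C => ψ x) u.comp

/-- **Every étale algebra over `C` has a model**: the model of an étale `A`-algebra `P` with a
map `ψ : P → C` (choose a finite presentation of `P`). [folklore] -/
theorem exists_model (P : Type u) [CommRing P] [Algebra A P] [Algebra.Etale A P]
    (ψ : P →ₐ[A] C) : ∃ (j : EtaleModel A C) (e : j.ring ≃ₐ[A] P), j.hom = ψ.comp e.toAlgHom := by
  obtain ⟨n, π, hπ, -⟩ := Algebra.FinitePresentation.out (R := A) (A := P)
  let e : (MvPolynomial (Fin n) A ⧸ RingHom.ker π) ≃ₐ[A] P :=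
    Ideal.quotientKerAlgEquivOfSurjective hπ
  exact ⟨⟨n, RingHom.ker π, Algebra.Etale.of_equiv e.symm, ψ.comp e.toAlgHom⟩, e, rfl⟩

end EtaleModel

/-! ### Filteredness -/

namespace EtaleModel

variable {A C}

/-- The tensor product of two étale `A`-algebras is étale. [cite: StacksProject, Tag 00U0] -/
theorem etale_tensor (P Q : Type u) [CommRing P] [Algebra A P] [Algebra.Etale A P]
    [CommRing Q] [Algebra A Q] [Algebra.Etale A Q] : Algebra.Etale A (P ⊗[A] Q) :=
  Algebra.Etale.comp A P (P ⊗[A] Q)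

/-- **Sums of étale models**: two models map to the model of the tensor product.
[cite: StacksProject, Tag 097I] -/
theorem cocone_objs (X Y : EtaleModel A C) :
    ∃ (Z : EtaleModel A C) (_ : X ⟶ Z) (_ : Y ⟶ Z), True := by
  haveI := etale_tensor (A := A) X.ring Y.ring
  obtain ⟨Z, e, hZ⟩ := exists_model (A := A) (C := C) (X.ring ⊗[A] Y.ring)
    (Algebra.TensorProduct.productMap X.hom Y.hom)
  refine ⟨Z, ⟨e.symm.toAlgHom.comp Algebra.TensorProduct.includeLeft, ?_⟩,
    ⟨e.symm.toAlgHom.comp Algebra.TensorProduct.includeRight, ?_⟩, trivial⟩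
  · rw [hZ, AlgHom.comp_assoc, ← AlgHom.comp_assoc e.toAlgHom, AlgEquiv.comp_symm,
      AlgHom.id_comp, Algebra.TensorProduct.productMap_left]
  · rw [hZ, AlgHom.comp_assoc, ← AlgHom.comp_assoc e.toAlgHom, AlgEquiv.comp_symm,
      AlgHom.id_comp, Algebra.TensorProduct.productMap_right]

set_option maxHeartbeats 800000 in
/-- **Coequalizers of étale models** (using the factorization criterion only through
`exists_model`, i.e. not at all): two parallel morphisms `u, v : X ⇉ Y` are coequalized by
`Y → Y ⊗_{X ⊗ X} X` (the pushout of the étale multiplication map `X ⊗ X → X` along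
`u ⊗ v : X ⊗ X → Y`), which is étale over `A`. [cite: StacksProject, Tag 097I] -/
theorem cocone_maps {X Y : EtaleModel A C} (u v : X ⟶ Y) :
    ∃ (Z : EtaleModel A C) (w : Y ⟶ Z), u ≫ w = v ≫ w := by
  haveI : Algebra.Etale A (X.ring ⊗[A] X.ring) := etale_tensor X.ring X.ring
  -- `Y` and `X` as `X ⊗ X`-algebras through `u ⊗ v` and the multiplication
  letI : Algebra (X.ring ⊗[A] X.ring) Y.ring :=
    (Algebra.TensorProduct.productMap u.toAlgHom v.toAlgHom).toRingHom.toAlgebra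
  letI : Algebra (X.ring ⊗[A] X.ring) X.ring :=
    (Algebra.TensorProduct.lmul' (S := X.ring) A).toRingHom.toAlgebra
  have hRY : ∀ r : X.ring ⊗[A] X.ring, algebraMap (X.ring ⊗[A] X.ring) Y.ring r =
      Algebra.TensorProduct.productMap u.toAlgHom v.toAlgHom r :=
    fun r => by rw [RingHom.algebraMap_toAlgebra]; rfl
  have hRX : ∀ r : X.ring ⊗[A] X.ring, algebraMap (X.ring ⊗[A] X.ring) X.ring r =
      Algebra.TensorProduct.lmul' (S := X.ring) A r :=
    fun r => by rw [RingHom.algebraMap_toAlgebra]; rfl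
  haveI : IsScalarTower A (X.ring ⊗[A] X.ring) Y.ring :=
    IsScalarTower.of_algebraMap_eq (R := A) (S := X.ring ⊗[A] X.ring) (A := Y.ring) fun a => by
      rw [hRY, AlgHom.commutes]
  haveI : IsScalarTower A (X.ring ⊗[A] X.ring) X.ring :=
    IsScalarTower.of_algebraMap_eq (R := A) (S := X.ring ⊗[A] X.ring) (A := X.ring) fun a => by
      rw [hRX, AlgHom.commutes]
  haveI : Algebra.Etale (X.ring ⊗[A] X.ring) X.ring :=
    Algebra.Etale.of_restrictScalars A (X.ring ⊗[A] X.ring) X.ring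
  haveI : SMulCommClass (X.ring ⊗[A] X.ring) A Y.ring :=
    ⟨fun r a y => by rw [Algebra.smul_def r, Algebra.smul_def r]; exact mul_smul_comm a _ y⟩
  -- (towers over the base `X ⊗ X`, spelled out for the locally defined algebra structures)
  haveI : IsScalarTower (X.ring ⊗[A] X.ring) (X.ring ⊗[A] X.ring) Y.ring :=
    ⟨fun r s y => by rw [smul_eq_mul, Algebra.smul_def, Algebra.smul_def, Algebra.smul_def, map_mul,
      mul_assoc]⟩
  haveI : IsScalarTower (X.ring ⊗[A] X.ring) (X.ring ⊗[A] X.ring) X.ring :=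
    ⟨fun r s y => by rw [smul_eq_mul, Algebra.smul_def, Algebra.smul_def, Algebra.smul_def, map_mul,
      mul_assoc]⟩
  haveI : SMulCommClass (X.ring ⊗[A] X.ring) (X.ring ⊗[A] X.ring) Y.ring :=
    ⟨fun r s y => by rw [Algebra.smul_def, Algebra.smul_def, Algebra.smul_def, Algebra.smul_def,
      mul_left_comm]⟩
  haveI : Algebra.Etale Y.ring (Y.ring ⊗[X.ring ⊗[A] X.ring] X.ring) :=
    Algebra.Etale.baseChange (R := X.ring ⊗[A] X.ring) (A := X.ring) (B := Y.ring)
  haveI : Algebra.Etale A (Y.ring ⊗[X.ring ⊗[A] X.ring] X.ring) :=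
    Algebra.Etale.comp A Y.ring (Y.ring ⊗[X.ring ⊗[A] X.ring] X.ring)
  -- `C` as an `X ⊗ X`-algebra through `X`
  letI : Algebra (X.ring ⊗[A] X.ring) C :=
    (X.hom.toRingHom.comp (algebraMap (X.ring ⊗[A] X.ring) X.ring)).toAlgebra
  have hRC : ∀ r : X.ring ⊗[A] X.ring, algebraMap (X.ring ⊗[A] X.ring) C r =
      X.hom (algebraMap (X.ring ⊗[A] X.ring) X.ring r) := fun r => by
    rw [RingHom.algebraMap_toAlgebra (X.hom.toRingHom.comp (algebraMap (X.ring ⊗[A] X.ring) X.ring))]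
    rfl
  haveI : IsScalarTower A (X.ring ⊗[A] X.ring) C :=
    IsScalarTower.of_algebraMap_eq (R := A) (S := X.ring ⊗[A] X.ring) (A := C) fun a => by
      rw [hRC, ← IsScalarTower.algebraMap_apply, AlgHom.commutes]
  haveI : IsScalarTower (X.ring ⊗[A] X.ring) (X.ring ⊗[A] X.ring) C :=
    ⟨fun r s y => by rw [smul_eq_mul, Algebra.smul_def, Algebra.smul_def, Algebra.smul_def, map_mul,
      mul_assoc]⟩
  have hYu : Y.hom.comp (Algebra.TensorProduct.productMap u.toAlgHom v.toAlgHom) =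
      X.hom.comp (Algebra.TensorProduct.lmul' (S := X.ring) A) := by
    refine Algebra.TensorProduct.ext' fun x x' => ?_
    simp only [AlgHom.comp_apply, Algebra.TensorProduct.productMap_apply_tmul, map_mul,
      Algebra.TensorProduct.lmul'_apply_tmul, hom_comp_apply]
  let fR : Y.ring →ₐ[X.ring ⊗[A] X.ring] C :=
    { Y.hom.toRingHom with
      commutes' := fun r => by
        change Y.hom (algebraMap (X.ring ⊗[A] X.ring) Y.ring r) = algebraMap (X.ring ⊗[A] X.ring) C r
        rw [hRC, hRY, hRX]
        exact congrArg (fun ψ : X.ring ⊗[A] X.ring →ₐ[A] C => ψ r) hYu }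
  let gR : X.ring →ₐ[X.ring ⊗[A] X.ring] C :=
    { X.hom.toRingHom with commutes' := fun r => (hRC r).symm }
  have hfg : ∀ y x, Commute (fR y) (gR x) := fun _ _ => Commute.all _ _
  let ψ : Y.ring ⊗[X.ring ⊗[A] X.ring] X.ring →ₐ[A] C :=
    (Algebra.TensorProduct.lift fR gR hfg).restrictScalars A
  have hψ : ∀ (y : Y.ring) (x : X.ring), ψ (y ⊗ₜ x) = Y.hom y * X.hom x := fun y x => by
    change Algebra.TensorProduct.lift fR gR hfg (y ⊗ₜ x) = _
    rw [Algebra.TensorProduct.lift_tmul]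
    rfl
  obtain ⟨Z, e, hZ⟩ := exists_model (A := A) (C := C) (Y.ring ⊗[X.ring ⊗[A] X.ring] X.ring) ψ
  let ι : Y.ring →ₐ[A] Y.ring ⊗[X.ring ⊗[A] X.ring] X.ring := Algebra.TensorProduct.includeLeft
  have hι : ∀ y : Y.ring, ι y = y ⊗ₜ (1 : X.ring) := fun _ => rfl
  refine ⟨Z, ⟨e.symm.toAlgHom.comp ι, ?_⟩, ?_⟩
  · rw [hZ, AlgHom.comp_assoc, ← AlgHom.comp_assoc e.toAlgHom, AlgEquiv.comp_symm, AlgHom.id_comp]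
    ext y
    rw [AlgHom.comp_apply, hι, hψ, map_one, mul_one]
  · refine Hom.ext (AlgHom.ext fun x => ?_)
    have hu : u.toAlgHom x =
        Algebra.TensorProduct.productMap u.toAlgHom v.toAlgHom (x ⊗ₜ[A] (1 : X.ring)) := by
      rw [Algebra.TensorProduct.productMap_apply_tmul, map_one, mul_one]
    have hv : v.toAlgHom x =
        Algebra.TensorProduct.productMap u.toAlgHom v.toAlgHom ((1 : X.ring) ⊗ₜ[A] x) := by
      rw [Algebra.TensorProduct.productMap_apply_tmul, map_one, one_mul]
    have key : ι (u.toAlgHom x) = ι (v.toAlgHom x) := by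
      rw [hι, hι, hu, hv, ← hRY, ← hRY, ← Algebra.TensorProduct.algebraMap_apply (S := X.ring ⊗[A] X.ring),
        ← Algebra.TensorProduct.algebraMap_apply (S := X.ring ⊗[A] X.ring),
        Algebra.TensorProduct.algebraMap_apply', Algebra.TensorProduct.algebraMap_apply', hRX, hRX,
        Algebra.TensorProduct.lmul'_apply_tmul, Algebra.TensorProduct.lmul'_apply_tmul, one_mul,
        mul_one]
    change e.symm.toAlgHom (ι (u.toAlgHom x)) = e.symm.toAlgHom (ι (v.toAlgHom x))
    rw [key]

/-- **The category of étale models over `C` is filtered when `C` satisfies the factorization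
criterion** (nonempty: `A` itself; sums: tensor products; coequalizers: pushouts).
[cite: StacksProject, Tag 097I] -/
theorem isFiltered : IsFiltered (EtaleModel A C) := by
  haveI : Nonempty (EtaleModel A C) :=
    ⟨(exists_model (A := A) (C := C) A (Algebra.ofId A C)).choose⟩
  haveI : IsFilteredOrEmpty (EtaleModel A C) := ⟨cocone_objs, fun _ _ u v => cocone_maps u v⟩
  exact IsFiltered.mk

end EtaleModel


/-! ### Directed systems of étale models and the presentation theorem -/

namespace EtaleModel

variable {A C}
variable {α : Type u} [PartialOrder α] (F : α ⥤ EtaleModel A C)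

/-- The stages of the directed system of étale algebras indexed by a poset mapping to the
category of étale models. [folklore] -/
abbrev stage (a : α) : Type u := (F.obj a).ring

/-- The transition maps of the directed system. [folklore] -/
noncomputable def stageMap (a b : α) (h : a ≤ b) : stage F a →ₐ[A] stage F b :=
  (F.map (homOfLE h)).toAlgHom

/-- `stageMap` unfolded. [folklore] -/
theorem stageMap_apply (a b : α) (h : a ≤ b) (x : stage F a) :
    stageMap F a b h x = (F.map (homOfLE h)).toAlgHom x := rfl

/-- Functoriality makes the stages a directed system. [folklore] -/
instance stage_directedSystem : DirectedSystem (stage F) (stageMap F · · ·) where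
  map_self := fun a x => by
    rw [stageMap_apply, show homOfLE (le_refl a) = 𝟙 a from rfl, F.map_id]
    rfl
  map_map := fun c b a hab hbc x => by
    rw [stageMap_apply, stageMap_apply, stageMap_apply, ← AlgHom.comp_apply, ← comp_toAlgHom,
      ← F.map_comp]
    rfl

variable [Nonempty α] [IsDirectedOrder α]

/-- The comparison map `colimₐ (F a) → C`. [folklore] -/
noncomputable def toBase : DirectLimit (stage F) (stageMap F) →ₐ[A] C :=
  DirectLimit.Algebra.lift _ _ C (fun a => (F.obj a).hom) fun _ _ h x =>
    hom_comp_apply (F.map (homOfLE h)) x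

/-- `toBase` on the stages. [folklore] -/
theorem toBase_of (a : α) (x : stage F a) :
    toBase F (DirectLimit.Algebra.of (stage F) (stageMap F) a x) = (F.obj a).hom x := rfl

/-- **Surjectivity of the comparison map** for a final functor, under the factorization
criterion: every `c ∈ C` is reached through an étale algebra (`A[X] → C`, `X ↦ c`, factors),
i.e. through an étale model, i.e. through some `F a`. [cite: StacksProject, Tag 097I] -/
theorem toBase_surjective [F.Final] (hC : FactorsEtale A C) : Function.Surjective (toBase F) := by
  haveI : IsFiltered α := isFiltered_of_directed_le_nonempty α
  intro c
  obtain ⟨B, _, _, _, α', β', hαβ⟩ := hC (Polynomial A) (Polynomial.aeval c)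
  obtain ⟨j, e, hj⟩ := exists_model (A := A) (C := C) B β'
  obtain ⟨a, ⟨u⟩⟩ := ((Functor.final_iff_of_isFiltered F).1 inferInstance).1 j
  refine ⟨DirectLimit.Algebra.of (stage F) (stageMap F) a (u.toAlgHom (e.symm (α' Polynomial.X))), ?_⟩
  rw [toBase_of, hom_comp_apply, hj, AlgHom.comp_apply, AlgEquiv.coe_toAlgHom,
    AlgEquiv.apply_symm_apply, ← AlgHom.comp_apply, hαβ, Polynomial.aeval_X]

/-- **Injectivity of the comparison map** for a final functor, under the factorization
criterion: an element of `F a` killed in `C` is killed by a morphism of étale models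
(`(F a)/(b) → C` factors through an étale algebra), and a final functor out of a directed poset
coequalizes it with a transition map (`Functor.Final.exists_coeq`).
[cite: StacksProject, Tag 0032] -/
theorem toBase_injective [F.Final] (hC : FactorsEtale A C) : Function.Injective (toBase F) := by
  haveI : IsFiltered α := isFiltered_of_directed_le_nonempty α
  rw [injective_iff_map_eq_zero]
  intro z hz
  induction z using DirectLimit.induction with | _ a b
  change DirectLimit.Algebra.of (stage F) (stageMap F) a b = 0
  change toBase F (DirectLimit.Algebra.of (stage F) (stageMap F) a b) = 0 at hz
  rw [toBase_of] at hz
  -- the quotient `(F a)/(b) → C` factors through an étale model `j'`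
  let Q : Type u := (F.obj a).ring ⧸ Ideal.span {b}
  haveI : Algebra.FinitePresentation A Q :=
    Algebra.FinitePresentation.quotient (Submodule.fg_span_singleton b)
  let φQ : Q →ₐ[A] C := Ideal.Quotient.liftₐ (Ideal.span {b}) (F.obj a).hom fun x hx => by
    obtain ⟨r, rfl⟩ := Ideal.mem_span_singleton'.1 hx
    rw [map_mul, hz, mul_zero]
  obtain ⟨B', _, _, _, α', β', hαβ⟩ := hC Q φQ
  obtain ⟨j', e', hj'⟩ := exists_model (A := A) (C := C) B' β'
  let vAlg : (F.obj a).ring →ₐ[A] j'.ring :=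
    e'.symm.toAlgHom.comp (α'.comp (Ideal.Quotient.mkₐ A (Ideal.span {b})))
  have hv : j'.hom.comp vAlg = (F.obj a).hom := by
    rw [hj']
    ext x
    change β' (e' (e'.symm (α' (Ideal.Quotient.mkₐ A (Ideal.span {b}) x)))) = (F.obj a).hom x
    rw [AlgEquiv.apply_symm_apply, ← AlgHom.comp_apply, hαβ]
    rfl
  let v : F.obj a ⟶ j' := ⟨vAlg, hv⟩
  have hvb : v.toAlgHom b = 0 := by
    change e'.symm (α' (Ideal.Quotient.mkₐ A (Ideal.span {b}) b)) = 0
    rw [Ideal.Quotient.mkₐ_eq_mk, Ideal.Quotient.eq_zero_iff_mem.2 (Ideal.mem_span_singleton_self b),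
      map_zero, map_zero]
  -- `j' → F a'`, and coequalize with a transition map
  obtain ⟨a', ⟨w⟩⟩ := ((Functor.final_iff_of_isFiltered F).1 inferInstance).1 j'
  obtain ⟨a₁, ha, ha'⟩ := exists_ge_ge a a'
  obtain ⟨a₂, t, ht⟩ := Functor.Final.exists_coeq F ((v ≫ w) ≫ F.map (homOfLE ha'))
    (F.map (homOfLE ha))
  have h12 : a₁ ≤ a₂ := leOfHom t
  have hmap : F.map (homOfLE (ha.trans h12)) = ((v ≫ w) ≫ F.map (homOfLE ha')) ≫ F.map t := by
    rw [ht, ← F.map_comp]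
    congr 1
  have hkill : stageMap F a a₂ (ha.trans h12) b = 0 := by
    rw [stageMap_apply, hmap, comp_toAlgHom, comp_toAlgHom, comp_toAlgHom, AlgHom.comp_apply,
      AlgHom.comp_apply, AlgHom.comp_apply, hvb, map_zero, map_zero, map_zero]
  rw [← DirectLimit.Algebra.of_f (G := stage F) (f := stageMap F) (ha.trans h12), hkill, map_zero]

end EtaleModel

/-- **Presentation theorem** (ind-étale algebras as directed colimits): if `C` satisfies the
factorization criterion over `A`, then `C ≅ colimᵢ Gᵢ` for a directed system of étale
`A`-algebras over a nonempty directed preorder (the filtered category of étale models over `C`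
has a final functor from a directed poset by Deligne's argument, Stacks Tag 0032 = Mathlib
`IsFiltered.exists_directed`; the comparison map is bijective). [cite: StacksProject, Tag 097I] -/
theorem FactorsEtale.exists_directLimit_equiv {A C : Type u} [CommRing A] [CommRing C] [Algebra A C]
    (hC : FactorsEtale A C) :
    ∃ (ι : Type u) (_ : Preorder ι) (_ : Nonempty ι) (_ : IsDirectedOrder ι)
      (G : ι → Type u) (_ : ∀ i, CommRing (G i)) (_ : ∀ i, Algebra A (G i))
      (_ : ∀ i, Algebra.Etale A (G i))
      (f : ∀ i j, i ≤ j → G i →ₐ[A] G j) (_ : DirectedSystem G (f · · ·)),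
      Nonempty (DirectLimit G f ≃ₐ[A] C) := by
  haveI : IsFiltered (EtaleModel A C) := EtaleModel.isFiltered
  obtain ⟨α, _, hdir, hne, F, hF⟩ := IsFiltered.exists_directed (EtaleModel A C)
  haveI : IsDirectedOrder α := hdir
  exact ⟨α, inferInstance, hne, hdir, EtaleModel.stage F, inferInstance, inferInstance, inferInstance,
    EtaleModel.stageMap F, inferInstance,
    ⟨AlgEquiv.ofBijective (EtaleModel.toBase F)
      ⟨EtaleModel.toBase_injective F hC, EtaleModel.toBase_surjective F hC⟩⟩⟩

/-- Conversely, an algebra isomorphic to a directed colimit of étale algebras satisfies the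
factorization criterion. [cite: StacksProject, Tag 097I] -/
theorem FactorsEtale.of_directLimit_equiv {A C : Type u} [CommRing A] [CommRing C] [Algebra A C]
    {ι : Type u} [Preorder ι] [Nonempty ι] [IsDirectedOrder ι] {G : ι → Type u}
    [∀ i, CommRing (G i)] [∀ i, Algebra A (G i)] [∀ i, Algebra.Etale A (G i)]
    (f : ∀ i j, i ≤ j → G i →ₐ[A] G j) [DirectedSystem G (f · · ·)] (e : DirectLimit G f ≃ₐ[A] C) :
    FactorsEtale A C :=
  (FactorsEtale.directLimit_of_etale f).of_equiv e

/-! ### Transitivity, base change, localization -/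

/-- **Transitivity of the factorization criterion** (ind-étale over ind-étale is ind-étale):
`FactorsEtale A B → FactorsEtale B C → FactorsEtale A C` (present `B` as a directed colimit of
étale `A`-algebras and use `FactorsEtale.of_etale_over_directLimit`).
[cite: StacksProject, Tag 097K] -/
theorem FactorsEtale.trans {A B C : Type u} [CommRing A] [CommRing B] [CommRing C] [Algebra A B]
    [Algebra A C] [Algebra B C] [IsScalarTower A B C] (hB : FactorsEtale A B)
    (hC : FactorsEtale B C) : FactorsEtale A C := by
  obtain ⟨ι, _, _, _, G, _, _, _, f, _, ⟨e⟩⟩ := hB.exists_directLimit_equiv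
  intro P _ _ _ φ
  let φ' : B ⊗[A] P →ₐ[B] C :=
    Algebra.TensorProduct.lift (Algebra.ofId B C) φ (fun _ _ => Commute.all _ _)
  obtain ⟨E, _, _, _, α, β, hαβ⟩ := hC (B ⊗[A] P) φ'
  -- `E` as an algebra over `L = colim G ≅ B`
  letI : Algebra (DirectLimit G f) B := e.toRingHom.toAlgebra
  letI : Algebra A E := ((algebraMap B E).comp (algebraMap A B)).toAlgebra
  letI : Algebra (DirectLimit G f) E := ((algebraMap B E).comp (algebraMap (DirectLimit G f) B)).toAlgebra
  haveI : IsScalarTower A B E := IsScalarTower.of_algebraMap_eq fun _ => rfl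
  haveI : IsScalarTower (DirectLimit G f) B E := IsScalarTower.of_algebraMap_eq fun _ => rfl
  have hLB : ∀ x, algebraMap (DirectLimit G f) B x = e x := fun _ => rfl
  haveI : IsScalarTower A (DirectLimit G f) B :=
    IsScalarTower.of_algebraMap_eq fun a => by rw [hLB, e.commutes]
  haveI : IsScalarTower A (DirectLimit G f) E :=
    IsScalarTower.of_algebraMap_eq fun a => by
      rw [IsScalarTower.algebraMap_apply (DirectLimit G f) B E, ← IsScalarTower.algebraMap_apply A,
        IsScalarTower.algebraMap_apply A B E]
  let eL : DirectLimit G f ≃ₐ[DirectLimit G f] B := { e with commutes' := fun _ => rfl }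
  haveI : Algebra.Etale (DirectLimit G f) B := Algebra.Etale.of_equiv eL
  haveI : Algebra.Etale (DirectLimit G f) E := Algebra.Etale.comp (DirectLimit G f) B E
  have hE : FactorsEtale A E := FactorsEtale.of_etale_over_directLimit f E
  obtain ⟨B', _, _, _, α', β', hαβ'⟩ :=
    hE P ((α.restrictScalars A).comp Algebra.TensorProduct.includeRight)
  refine ⟨B', inferInstance, inferInstance, inferInstance, α', (β.restrictScalars A).comp β', ?_⟩
  rw [AlgHom.comp_assoc, hαβ']
  ext p
  have := congrArg (fun ψ : B ⊗[A] P →ₐ[B] C => ψ (1 ⊗ₜ p)) hαβ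
  simpa [φ'] using this

/-- **Base change of the factorization criterion** (ind-étale is stable under base change):
`FactorsEtale A B → FactorsEtale R' (R' ⊗ B)` (present `B` as a directed colimit of étale
algebras; tensor products commute with directed colimits). [cite: StacksProject, Tag 097J] -/
theorem FactorsEtale.baseChange {A B : Type u} [CommRing A] [CommRing B] [Algebra A B]
    (hB : FactorsEtale A B) (R' : Type u) [CommRing R'] [Algebra A R'] :
    FactorsEtale R' (R' ⊗[A] B) := by
  obtain ⟨ι, _, _, _, G, _, _, _, f, _, ⟨e⟩⟩ := hB.exists_directLimit_equiv
  have h1 : FactorsEtale R' (BaseChangeDirectLimit f R') :=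
    FactorsEtale.directLimit_of_etale (bcTransition f R')
  exact h1.of_equiv ((baseChangeDirectLimitEquiv f R').symm.trans
    (Algebra.TensorProduct.congr (AlgEquiv.refl : R' ≃ₐ[R'] R') e))

/-- **Localizations of algebras satisfying the criterion satisfy it** (over the original base).
[cite: StacksProject, Tag 097K] -/
theorem FactorsEtale.localization {A C : Type u} [CommRing A] [CommRing C] [Algebra A C]
    (hC : FactorsEtale A C) (S : Submonoid C) (C' : Type u) [CommRing C'] [Algebra C C']
    [IsLocalization S C'] [Algebra A C'] [IsScalarTower A C C'] : FactorsEtale A C' :=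
  hC.trans (FactorsEtale.of_isLocalization S C')

end Literature.RingTheory.Etale
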